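import Summits.CriticalPhenomena.Ising3DConformalLimit.Theorems.HyperoctahedralRPExistsScaleCovariantLimitRegularityGivesPrecompact
import Summits.CriticalPhenomena.Ising3DConformalLimit.Theses.MirrorHoelderCompactness
import HarnessLib

/-!
# Pair equicontinuity from `SeparableHoelder`: at order two every configuration is separable
(stub F4 `stub_pairEquicont_of_separableHoelder` of line `Sketch`, crux `ExistsScaleCovariantLimit`,
item stmt-CriticalPhenomena-1981, route `HyperoctahedralRP`; lead c4, 2026-08-16)

Route `MirrorHoelderCompactness` files its compactness chain as TwoPointDoubling (item 6150) → SeparableHoelder (item 6151,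
the Hölder-`1/2` modulus under moves of ONE point separated from the others by one of the nine mirror normals) →
NonSeparableModulus (item 6152, the "honestly open complement" at caged configurations) → UniformRegularity (item 4658).
At ORDER TWO there are no caged configurations: for a non-coincident pair `x₀ ≠ x₁` some coordinate `τ` carries half the
squared distance, `3|x₁ τ − x₀ τ|² ≥ ‖x₁ − x₀‖²` (so `|x₁ τ − x₀ τ| ≥ ‖x₁ − x₀‖/2`) (`exists_sq_norm_le_three_mul_sq`: `‖v‖² ≤ 3v_τ²`), so the coordinate normal `e_τ` separates the moving
point from the other one with margin `s_K/2`, `s_K > 0` the pair separation on the compact `K` (`exists_pairSep`). Hence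
items 6150 ∧ 6151 already give clause (b) of item 4658 AT ORDER TWO — uniform asymptotic equicontinuity of the pinned pair
zoom — by two one-point moves `(x₀,x₁) → (x₀,y₁) = (y with y₀ ↦ x₀) ← (y₀,y₁)`, each based at a configuration of `K`.
With items 6157 (`rescaledBounds_proof`, clauses (a), (c) from 6150, LANDED) and the line's F1–F3 (pair regularity ⟹ item
5955) this yields `OrbitPrecompact ⟸ TwoPointDoubling ∧ SeparableHoelder`, bypassing item 6152 entirely; with the landed
D (5955 ⟹ 6150): under item 6151, items 5955, 4658 and 6150 are EQUIVALENT.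

References: M. Aizenman, H. Duminil-Copin, Ann. Math. 194 (2021) §5–6 [AizenmanDuminilCopinAnnals2021]. No definitions, no `sorry`.
-/

noncomputable section

namespace Summit.CriticalPhenomena.Ising3DConformalLimit.Cruxes.ExistsScaleCovariantLimit.TwoHierarchies

open Literature.Probability.LatticeModels Filter Set Function
open scoped Topology
open Summit.CriticalPhenomena.Ising3DConformalLimit.MoebiusLimitExistsOnlyInteraction (rhoPin)

/-- Some coordinate carries a third of the squared Euclidean norm in `ℝ³`: `‖v‖² ≤ 3 v_k²` for some `k`
(the largest coordinate square is at least the mean). [folklore] -/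
theorem exists_sq_norm_le_three_mul_sq (v : EuclideanSpace ℝ (Fin 3)) :
    ∃ k : Fin 3, ‖v‖ ^ 2 ≤ 3 * (v k) ^ 2 := by
  by_contra h
  push Not at h
  have hsum := EuclideanSpace.real_norm_sq_eq v
  rw [Fin.sum_univ_three] at hsum
  nlinarith [h 0, h 1, h 2]

/-- On a compact set of non-coincident PAIRS the pair distance is bounded below by a positive constant. [folklore] -/
theorem exists_pairSep_two {K : Set (Fin 2 → EuclideanSpace ℝ (Fin 3))}
    (hKs : K ⊆ NonCoincident 3 2) (hK : IsCompact K) :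
    ∃ r : ℝ, 0 < r ∧ ∀ x ∈ K, ∀ j j' : Fin 2, j ≠ j' → r ≤ ‖x j - x j'‖ := by
  -- adapted from …MirrorHoelderCompactnessSeparableHoelderFloors.lean `exists_pairSep`
  rcases K.eq_empty_or_nonempty with hKe | hKne
  · exact ⟨1, one_pos, fun x hx => by simp [hKe] at hx⟩
  have hcont : Continuous fun x : Fin 2 → EuclideanSpace ℝ (Fin 3) => ‖x 0 - x 1‖ :=
    ((continuous_apply 0).sub (continuous_apply 1)).norm
  obtain ⟨x₀, hx₀, hmin⟩ := hK.exists_isMinOn hKne hcont.continuousOn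
  have hpos : 0 < ‖x₀ 0 - x₀ 1‖ := by
    rw [norm_pos_iff, sub_ne_zero]
    exact fun h => ((mem_nonCoincident x₀).1 (hKs hx₀)).ne (by decide) h
  refine ⟨‖x₀ 0 - x₀ 1‖, hpos, fun x hx j j' hjj' => ?_⟩
  have h01 : ‖x₀ 0 - x₀ 1‖ ≤ ‖x 0 - x 1‖ := hmin hx
  have hcases : (j = 0 ∧ j' = 1) ∨ (j = 1 ∧ j' = 0) := by omega
  rcases hcases with ⟨rfl, rfl⟩ | ⟨rfl, rfl⟩
  · exact h01
  · rw [norm_sub_rev (x 1)]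
    exact h01

/-- At order two the nine-normal separation clause of `SeparableHoelder` ALWAYS holds with margin `s/2`, `s ≤ ‖x 1 − x 0‖`:
some coordinate normal `e_τ` has `|x 1 τ − x 0 τ| ≥ ‖x 1 − x 0‖/2`. Stated for the moving index `i` and the other index
`j` of a pair. [folklore] -/
theorem pair_separable {x : Fin 2 → EuclideanSpace ℝ (Fin 3)} {s : ℝ} {i j : Fin 2} (hij : i ≠ j)
    (hs : s ≤ ‖x i - x j‖) :
    ∃ u : EuclideanSpace ℝ (Fin 3),
      (∃ i j : Fin 3, i ≠ j ∧ (u = EuclideanSpace.single i 1 ∨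
        u = EuclideanSpace.single i 1 + EuclideanSpace.single j 1 ∨
        u = EuclideanSpace.single i 1 - EuclideanSpace.single j 1)) ∧
      ((∀ j' : Fin 2, j' ≠ i → inner ℝ u (x j') + s / 2 ≤ inner ℝ u (x i)) ∨
        (∀ j' : Fin 2, j' ≠ i → inner ℝ u (x i) + s / 2 ≤ inner ℝ u (x j'))) := by
  obtain ⟨τ, hτ⟩ := exists_sq_norm_le_three_mul_sq (x i - x j)
  -- another coordinate index, for the (irrelevant) second index of the normal family
  obtain ⟨τ', hτ'⟩ : ∃ τ' : Fin 3, τ ≠ τ' := ⟨τ + 1, by simp⟩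
  have hother : ∀ j' : Fin 2, j' ≠ i → j' = j := by
    intro j' hj'
    omega
  have hinner : ∀ v : EuclideanSpace ℝ (Fin 3), inner ℝ (EuclideanSpace.single τ (1 : ℝ)) v = v τ := by
    intro v
    rw [EuclideanSpace.inner_single_left]
    simp
  refine ⟨EuclideanSpace.single τ 1, ⟨τ, τ', hτ', Or.inl rfl⟩, ?_⟩
  have habs : s / 2 ≤ |(x i - x j) τ| := by
    rcases le_or_gt s 0 with hs0 | hs0
    · exact (by linarith : s / 2 ≤ 0).trans (abs_nonneg _)
    · have h1 : (s / 2) ^ 2 ≤ |(x i - x j) τ| ^ 2 := by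
        rw [sq_abs]
        nlinarith [norm_nonneg (x i - x j)]
      by_contra hlt
      push Not at hlt
      nlinarith [abs_nonneg ((x i - x j) τ)]
  rw [PiLp.sub_apply] at habs
  rcases le_or_gt 0 (x i τ - x j τ) with h | h
  · left
    intro j' hj'
    rw [hother j' hj', hinner, hinner]
    rw [abs_of_nonneg h] at habs
    linarith
  · right
    intro j' hj'
    rw [hother j' hj', hinner, hinner]
    rw [abs_of_neg h] at habs
    linarith

/-- **F4 (registered stub of line `Sketch`) — items 6150 ∧ 6151 give clause (b) of item 4658 AT ORDER TWO.**
`TwoPointDoubling → SeparableHoelder →` uniform asymptotic equicontinuity of the pinned pair zoom on every compact set of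
non-coincident pairs, uniformly in small `δ` (with `ρ_pin`; the renormalisation of 6151 is `ρ_pin`, `rhoStar_eq_rhoPin`).
Proof: pair separation `s > 0` on `K` (`exists_pairSep`); every pair of `K` is `e_τ`-separable with margin `s/2`
(`pair_separable`), so 6151 gives `C, δ₀, h₀` with `|F₂(x with xᵢ ↦ y) − F₂(x)| ≤ C(‖y − xᵢ‖ + δ)^{1/2}` for `x ∈ K`; for
`x, y ∈ K` write `F₂ x − F₂ y = [F₂ x − F₂(x₀,y₁)] + [F₂(y with y₀ ↦ x₀) − F₂ y]` (the middle configurations coincide), two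
one-point moves based in `K`, each `< ε/2` once `dist x y < r` and `δ < δ₁` with `C(r + δ₁)^{1/2} < ε/2`.
[cite: AizenmanDuminilCopinAnnals2021, arXiv:1912.07973 Remark 5.10 and Def. 5.11] -/
theorem stub_pairEquicont_of_separableHoelder :
    Summit.CriticalPhenomena.Ising3DConformalLimit.Theses.MirrorHoelderCompactness.TwoPointDoubling →
    Summit.CriticalPhenomena.Ising3DConformalLimit.Theses.MirrorHoelderCompactness.SeparableHoelder →
    ∀ K : Set (Fin 2 → EuclideanSpace ℝ (Fin 3)), K ⊆ NonCoincident 3 2 → IsCompact K →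
      ∀ ε : ℝ, 0 < ε → ∃ r δ₀ : ℝ, 0 < r ∧ 0 < δ₀ ∧ ∀ δ ∈ Set.Ioo 0 δ₀, ∀ x ∈ K, ∀ y ∈ K, dist x y < r →
        |rescaledCorrelator (criticalCorr 3) rhoPin 2 δ x - rescaledCorrelator (criticalCorr 3) rhoPin 2 δ y| < ε := by
  intro hD hSH K hKs hK ε hε
  obtain ⟨s, hs, hsK⟩ := exists_pairSep_two hKs hK
  obtain ⟨C, δ₀, h₀, hδ₀, hh₀, hH⟩ := hSH hD 2 K hKs hK (s / 2) (half_pos hs)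
  rw [rhoStar_eq_rhoPin] at hH
  -- the Hölder constant may be taken positive
  set C' : ℝ := max C 1 with hC'
  have hC'pos : 0 < C' := lt_of_lt_of_le one_pos (le_max_right _ _)
  have hH' : ∀ δ ∈ Set.Ioo 0 δ₀, ∀ x ∈ K, ∀ (i : Fin 2) (y : EuclideanSpace ℝ (Fin 3)), ‖y - x i‖ ≤ h₀ →
      |rescaledCorrelator (criticalCorr 3) rhoPin 2 δ (Function.update x i y) -
        rescaledCorrelator (criticalCorr 3) rhoPin 2 δ x| ≤ C' * (‖y - x i‖ + δ) ^ (1 / 2 : ℝ) := by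
    intro δ hδ x hx i y hy
    obtain ⟨j, hij⟩ : ∃ j : Fin 2, i ≠ j := ⟨i + 1, by simp⟩
    have hsep := pair_separable (x := x) hij (hsK x hx i j hij)
    refine (hH δ hδ x hx i y hy hsep).trans ?_
    exact mul_le_mul_of_nonneg_right (le_max_left _ _) (Real.rpow_nonneg (add_nonneg (norm_nonneg _) hδ.1.le) _)
  -- the scale `t` with `C' (2t)^{1/2} ≤ ε/2`: `2t = (ε / (4 C'))²`
  set t : ℝ := (ε / (4 * C')) ^ 2 / 2 with ht
  have htpos : 0 < t := by positivity
  have hCt : C' * (2 * t) ^ (1 / 2 : ℝ) < ε / 2 := by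
    have h2t : 2 * t = (ε / (4 * C')) ^ 2 := by
      rw [ht]; ring
    rw [h2t, ← Real.sqrt_eq_rpow, Real.sqrt_sq (by positivity)]
    have : C' * (ε / (4 * C')) = ε / 4 := by field_simp
    rw [this]
    linarith
  refine ⟨min t h₀, min t δ₀, lt_min htpos hh₀, lt_min htpos hδ₀, ?_⟩
  intro δ hδ x hx y hy hxy
  have hδ' : δ ∈ Set.Ioo 0 δ₀ := ⟨hδ.1, lt_of_lt_of_le hδ.2 (min_le_right _ _)⟩
  have hδt : δ < t := lt_of_lt_of_le hδ.2 (min_le_left _ _)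
  -- one-point moves are short
  have hmove : ∀ i : Fin 2, ‖y i - x i‖ < min t h₀ := fun i => by
    have h1 : dist (y i) (x i) ≤ dist y x := dist_le_pi_dist y x i
    rw [dist_comm y x] at h1
    rw [← dist_eq_norm]
    exact lt_of_le_of_lt h1 hxy
  have hbound : ∀ (z : Fin 2 → EuclideanSpace ℝ (Fin 3)), z ∈ K → ∀ (i : Fin 2) (w : EuclideanSpace ℝ (Fin 3)),
      ‖w - z i‖ < min t h₀ →
      |rescaledCorrelator (criticalCorr 3) rhoPin 2 δ (Function.update z i w) -
        rescaledCorrelator (criticalCorr 3) rhoPin 2 δ z| < ε / 2 := by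
    intro z hz i w hw
    have hw₀ : ‖w - z i‖ ≤ h₀ := (hw.le.trans (min_le_right _ _))
    have hwt : ‖w - z i‖ < t := lt_of_lt_of_le hw (min_le_left _ _)
    refine (hH' δ hδ' z hz i w hw₀).trans_lt (lt_of_le_of_lt ?_ hCt)
    refine mul_le_mul_of_nonneg_left (Real.rpow_le_rpow (add_nonneg (norm_nonneg _) hδ'.1.le) (by linarith)
      (by norm_num)) hC'pos.le
  -- the two moves: `x → (x with x₁ ↦ y₁) = (y with y₀ ↦ x₀) ← y`
  have hmid : Function.update x 1 (y 1) = Function.update y 0 (x 0) := by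
    funext l
    refine Fin.cases ?_ (fun l' => ?_) l
    · simp
    · have : l' = 0 := Subsingleton.elim _ _
      subst this
      simp
  have h1 := hbound x hx 1 (y 1) (hmove 1)
  have h2 := hbound y hy 0 (x 0) (by rw [norm_sub_rev]; exact hmove 0)
  rw [← hmid] at h2
  have htri := abs_sub_le (rescaledCorrelator (criticalCorr 3) rhoPin 2 δ x)
    (rescaledCorrelator (criticalCorr 3) rhoPin 2 δ (Function.update x 1 (y 1)))
    (rescaledCorrelator (criticalCorr 3) rhoPin 2 δ y)
  rw [abs_sub_comm] at h1
  linarith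

end Summit.CriticalPhenomena.Ising3DConformalLimit.Cruxes.ExistsScaleCovariantLimit.TwoHierarchies

end
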